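import Summits.Ventures.LatticeQCDFlow.TrivializingMaps.ZeroPinching
import Summits.Ventures.LatticeQCDFlow.TrivializingMaps.FisherRadiusIdentity
import Literature.NumberTheory.LFunctions.RHInvZetaBound

/-!
HONEST FRAMING: exact (Metropolis-corrected) sampling algorithms for lattice gauge theory; figures
of merit are autocorrelation/cost numbers at stated couplings and volumes; no continuum-physics
claim.

# FisherZerosExist — every fluctuating lattice action HAS Fisher zeros (non-vacuity of THEOREM S,
# F′, F″ and of the zero-set statements of rows 67–71, 92a–92e; lean-2 GEN-6, ours)

Venture-side (OURS, never `Literature/`). Cell `lqcd-flow` (pub-lqcd), unit `pub-lqcd-lean-2-g6`,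
2026-08-22.

Every obstruction theorem of theory-1's Fisher family is quantified over "a zero `s₀` of
`Z_L(s) = ∫ D[U] e^{-sS}`" (`FisherRadiusCap`, `FisherRadiusExact`, `FisherStaircase*`): the
radius of Lüscher's series is capped by `|s₀|`, every `η`-margined staircase past `s₀` has
`≥ ℓ/log(1/η)` stages, and so on. This file proves that the hypothesis is INHABITED as soon as the
action fluctuates in the trivial theory — so those theorems are never vacuous for an action that is
not `D[U]`-a.e. constant:

* **`exists_zero_complexMGF_of_variance_pos`** (pure probability / complex analysis): if `X` is a
  bounded real random variable under a probability measure with `Var X > 0`, then its complex moment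
  generating function `z ↦ ∫ e^{zX} dμ` (an entire function of exponential type) has a zero.
  Proof: if it were zero-free, on every disc `|z| < R` it has a holomorphic logarithm `L_R` with
  `L_R(0) = 0` (tree `InvZetaRH.exists_log_of_ball`) and `Re L_R ≤ bR` (`|Z| ≤ e^{b|Re z|}`);
  Borel–Carathéodory (Mathlib) gives `|L_R| ≤ 2(bR+1)` on `|z| ≤ R/2`, two Schwarz–Cauchy estimates
  give `|(Z′/Z)′(0)| ≤ 128(bR+1)/R²`, and `(Z′/Z)′(0) = Z″(0) - Z′(0)² = Var X`; `R → ∞` forces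
  `Var X = 0`.  (Classical: an entire function of exponential type without zeros is `e^{az+c}`
  — Hadamard; the route here avoids the factorisation theorem, which Mathlib does not have.)
* **`exists_actionZ_eq_zero_of_variance_pos`** (docked): for every smooth action `S` on the ambient
  link space with `Var_{D[U]}(S ∘ ι) > 0`, the partition function `Z(s) = complexMGF (-S ∘ ι) D[U]`
  has a Fisher zero `s₀`, necessarily with `Im s₀ ≠ 0` and `|s₀| ≥` every THEOREM-A-type radius.
* `actionZ_zeroSet_nonempty`, `infDist_actionZ_zeroSet_pos` — the zero set `F_Z` of rows 92d/92e is
  non-empty and at positive distance from every real coupling, so the greedy staircase of THEOREM S♯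
  moves (`x_{k+1} > x_k`) and THEOREM S's count is a genuine constraint.

NOT CLAIMED: the location or the number of zeros (infinitely many, classically) for any action,
volume or coupling; positivity of the variance of any specific action (for the Wilson plaquette
action with `d ≥ 2`, `n ≥ 2` it holds but is not proved in this file); anything about cost,
autocorrelation or the continuum.

References: THEORY-1.md §13, §24, §31; E. C. Titchmarsh, The Theory of Functions, 2nd ed., §8.2
(functions of exponential type); B. Ya. Levin, Distribution of Zeros of Entire Functions, Ch. I.
-/

open MeasureTheory ProbabilityTheory Filter Topology Complex Set Metric
open Literature.MathematicalPhysics.QuantumFieldTheory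
open Literature.MathematicalPhysics.QuantumFieldTheory.Luscher2010
open Literature.MathematicalPhysics.QuantumFieldTheory.WilsonFlow (coeConfig continuous_coeConfig)
open Literature.NumberTheory.LFunctions.InvZetaRH (exists_log_of_ball)
open scoped Matrix Matrix.Norms.Frobenius ContDiff

namespace Summit.Ventures.LatticeQCDFlow.TrivializingMaps

/-! ## §1 Bounded non-degenerate random variables: the Laplace transform has a zero -/

section General

variable {Ω : Type*} [MeasurableSpace Ω] {μ : Measure Ω} [IsProbabilityMeasure μ]
  {X : Ω → ℝ} {b : ℝ}

/-- Schwarz–Cauchy estimate in the form used twice below: a function differentiable on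
`ball c r` and bounded by `K` there has `‖f′(c)‖ ≤ 2K/r`. [folklore] -/
theorem norm_deriv_le_two_mul_div_of_norm_le {f : ℂ → ℂ} {c : ℂ} {r K : ℝ}
    (hr : 0 < r) (hf : DifferentiableOn ℂ f (ball c r)) (hK : ∀ z ∈ ball c r, ‖f z‖ ≤ K) :
    ‖deriv f c‖ ≤ 2 * K / r := by
  refine norm_deriv_le_div_of_mapsTo_ball hf (fun z hz => ?_) hr
  rw [mem_closedBall, dist_eq_norm]
  calc ‖f z - f c‖ ≤ ‖f z‖ + ‖f c‖ := norm_sub_le _ _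
    _ ≤ K + K := add_le_add (hK z hz) (hK c (mem_ball_self hr))
    _ = 2 * K := by ring

/-- `(Z′/Z)′(0) = Var X` for the complex MGF `Z` of a bounded random variable under a probability
measure (`Z(0) = 1`, `Z′(0) = E X`, `Z″(0) = E X²`). [folklore] -/
theorem deriv_logDeriv_complexMGF_zero (hm : AEMeasurable X μ)
    (hb : ∀ᵐ u ∂μ, |X u| ≤ b) :
    deriv (fun w => deriv (complexMGF X μ) w / complexMGF X μ w) 0 = ((variance X μ : ℝ) : ℂ) := by
  set Z := complexMGF X μ with hZdef
  have huniv : integrableExpSet X μ = univ := ZeroPinching.integrableExpSet_eq_univ_of_abs_le hm hb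
  have hint : ∀ z : ℂ, z.re ∈ interior (integrableExpSet X μ) := fun z => by
    rw [huniv, interior_univ]; exact mem_univ _
  have hZd : Differentiable ℂ Z := ZeroPinching.differentiable_complexMGF_of_abs_le hm hb
  have hZ'd : Differentiable ℂ (deriv Z) := by
    have h := (hZd.differentiableOn (s := univ)).deriv isOpen_univ
    exact differentiableOn_univ.mp h
  have hZ0 : Z 0 = 1 := by
    rw [hZdef, show (0 : ℂ) = ((0 : ℝ) : ℂ) from Complex.ofReal_zero.symm, complexMGF_ofReal,
      mgf_zero]
    simp
  have hZ1 : deriv Z 0 = ((∫ u, X u ∂μ : ℝ) : ℂ) := by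
    rw [← iteratedDeriv_one, hZdef, iteratedDeriv_complexMGF (hint 0) 1, ← integral_complex_ofReal]
    refine integral_congr_ae (ae_of_all _ fun u => ?_)
    simp
  have hZ2 : deriv (deriv Z) 0 = ((∫ u, X u ^ 2 ∂μ : ℝ) : ℂ) := by
    have h2 : deriv (deriv Z) = iteratedDeriv 2 Z := by
      rw [iteratedDeriv_succ, iteratedDeriv_one]
    rw [h2, hZdef, iteratedDeriv_complexMGF (hint 0) 2, ← integral_complex_ofReal]
    refine integral_congr_ae (ae_of_all _ fun u => ?_)
    simp
  have hmem : MemLp X 2 μ :=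
    MemLp.of_bound hm.aestronglyMeasurable b
      (hb.mono fun u h => by simpa [Real.norm_eq_abs] using h)
  rw [deriv_fun_div (hZ'd 0) (hZd 0) (by rw [hZ0]; exact one_ne_zero), hZ0, hZ1, hZ2,
    variance_eq_sub hmem]
  simp only [Pi.pow_apply, mul_one, one_pow, div_one]
  push_cast
  ring

/-- **A bounded random variable with positive variance has a complex-MGF zero.**  If `|X| ≤ b`
a.e. under a probability measure and `Var X > 0`, then `∫ e^{zX} dμ = 0` for some `z ∈ ℂ`: the
Laplace transform of a non-degenerate compactly supported law is an entire function of exponential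
type WITH zeros.  [folklore; Titchmarsh §8.2 / Hadamard, here via Borel–Carathéodory + Schwarz] -/
theorem exists_zero_complexMGF_of_variance_pos (hm : AEMeasurable X μ)
    (hb : ∀ᵐ u ∂μ, |X u| ≤ b) (hvar : 0 < variance X μ) : ∃ z : ℂ, complexMGF X μ z = 0 := by
  by_contra hcon
  have hne : ∀ z : ℂ, complexMGF X μ z ≠ 0 := fun z hz => hcon ⟨z, hz⟩
  set Z := complexMGF X μ with hZdef
  set G : ℂ → ℂ := fun w => deriv Z w / Z w with hGdef
  have hZd : Differentiable ℂ Z := ZeroPinching.differentiable_complexMGF_of_abs_le hm hb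
  have hZ'd : Differentiable ℂ (deriv Z) := by
    have h := (hZd.differentiableOn (s := univ)).deriv isOpen_univ
    exact differentiableOn_univ.mp h
  have hGd : Differentiable ℂ G := fun w => ((hZ'd w).div (hZd w) (hne w))
  have hZ0 : Z 0 = 1 := by
    rw [hZdef, show (0 : ℂ) = ((0 : ℝ) : ℂ) from Complex.ofReal_zero.symm, complexMGF_ofReal,
      mgf_zero]
    simp
  -- the growth bound `‖Z z‖ ≤ exp (B ‖z‖)`, `B = |b|`
  set B : ℝ := |b| with hBdef
  have hB0 : 0 ≤ B := abs_nonneg b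
  have hgrowth : ∀ z : ℂ, ‖Z z‖ ≤ Real.exp (B * ‖z‖) := fun z => by
    refine (norm_complexMGF_le_mgf).trans
      ((ZeroPinching.mgf_le_exp_of_abs_le hm hb z.re).trans ?_)
    refine Real.exp_le_exp.mpr ?_
    calc |z.re| * b ≤ |z.re| * B := mul_le_mul_of_nonneg_left (le_abs_self b) (abs_nonneg _)
      _ ≤ ‖z‖ * B := mul_le_mul_of_nonneg_right (abs_re_le_norm z) hB0
      _ = B * ‖z‖ := mul_comm _ _
  -- the key estimate: `‖G′(0)‖ ≤ 128 (B R + 1) / R²` for every `R > 0`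
  have hkey : ∀ R : ℝ, 0 < R → ‖deriv G 0‖ ≤ 128 * (B * R + 1) / R ^ 2 := by
    intro R hR
    obtain ⟨L, hLd, hL0, hLder, hLexp⟩ :=
      exists_log_of_ball (c := (0 : ℂ)) hR hZd.differentiableOn (fun z _ => hne z)
    have hL00 : L 0 = 0 := by rw [hL0, hZ0, Complex.log_one]
    set M : ℝ := B * R + 1 with hMdef
    have hM : 0 < M := by positivity
    -- `Re L ≤ M` on the disc
    have hre : MapsTo L (ball 0 R) {w : ℂ | w.re ≤ M} := by
      intro z hz
      have hzR : ‖z‖ < R := mem_ball_zero_iff.mp hz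
      have h1 : Real.exp (L z).re = ‖Z z‖ := by rw [← hLexp z hz, Complex.norm_exp]
      have h2 : Real.exp (L z).re ≤ Real.exp (B * R) := by
        rw [h1]
        exact (hgrowth z).trans (Real.exp_le_exp.mpr (mul_le_mul_of_nonneg_left hzR.le hB0))
      have h3 : (L z).re ≤ B * R := Real.exp_le_exp.mp h2
      show (L z).re ≤ M
      linarith
    -- Borel–Carathéodory: `‖L z‖ ≤ 2M` on `‖z‖ < R/2`
    have hBC : ∀ z ∈ ball (0 : ℂ) (R / 2), ‖L z‖ ≤ 2 * M := by
      intro z hz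
      have hz2 : ‖z‖ < R / 2 := mem_ball_zero_iff.mp hz
      have hzR : z ∈ ball (0 : ℂ) R := mem_ball_zero_iff.mpr (by linarith)
      have h := Complex.borelCaratheodory_zero hM hLd hre hR hzR hL00
      have hden : 0 < R - ‖z‖ := by linarith
      calc ‖L z‖ ≤ 2 * M * ‖z‖ / (R - ‖z‖) := h
        _ ≤ 2 * M := by
            rw [div_le_iff₀ hden]
            nlinarith [norm_nonneg z]
    -- first Cauchy estimate: `‖G w‖ ≤ 16 M / R` on `‖w‖ < R/4`
    have hG1 : ∀ w ∈ ball (0 : ℂ) (R / 4), ‖G w‖ ≤ 2 * (2 * M) / (R / 4) := by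
      intro w hw
      have hw4 : ‖w‖ < R / 4 := mem_ball_zero_iff.mp hw
      have hsub : ball w (R / 4) ⊆ ball (0 : ℂ) (R / 2) := fun z hz => by
        rw [mem_ball_zero_iff]
        have : ‖z - w‖ < R / 4 := mem_ball_iff_norm.mp hz
        calc ‖z‖ = ‖(z - w) + w‖ := by rw [sub_add_cancel]
          _ ≤ ‖z - w‖ + ‖w‖ := norm_add_le _ _
          _ < R / 2 := by linarith
      have hsubR : ball w (R / 4) ⊆ ball (0 : ℂ) R :=
        hsub.trans (ball_subset_ball (by linarith))
      have hderw : deriv L w = G w :=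
        (hLder w (hsubR (mem_ball_self (by positivity)))).deriv
      rw [← hderw]
      exact norm_deriv_le_two_mul_div_of_norm_le (by positivity) (hLd.mono hsubR)
        fun z hz => hBC z (hsub hz)
    -- second Cauchy estimate at `0`
    have hG2 : ‖deriv G 0‖ ≤ 2 * (2 * (2 * M) / (R / 4)) / (R / 4) :=
      norm_deriv_le_two_mul_div_of_norm_le (by positivity) hGd.differentiableOn hG1
    calc ‖deriv G 0‖ ≤ 2 * (2 * (2 * M) / (R / 4)) / (R / 4) := hG2
      _ = 128 * (B * R + 1) / R ^ 2 := by rw [hMdef]; field_simp; ring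
  -- `G′(0) = Var X`, so `Var X ≤ 128 (B R + 1)/R²` for every `R`; let `R → ∞`
  have hG0 : deriv G 0 = ((variance X μ : ℝ) : ℂ) := deriv_logDeriv_complexMGF_zero hm hb
  have hvarle : ∀ R : ℝ, 0 < R → variance X μ ≤ 128 * (B * R + 1) / R ^ 2 := fun R hR => by
    have h := hkey R hR
    rwa [hG0, Complex.norm_real, Real.norm_eq_abs, abs_of_pos hvar] at h
  -- choose `R` with `128 (B R + 1)/R² < Var X`
  set v := variance X μ with hvdef
  set R : ℝ := max 1 (512 * (B + 1) / v) with hRdef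
  have hR1 : 1 ≤ R := le_max_left _ _
  have hR0 : 0 < R := by linarith
  have hRv : 512 * (B + 1) / v ≤ R := le_max_right _ _
  have h1 : 128 * (B * R + 1) / R ^ 2 ≤ 128 * (B + 1) / R := by
    rw [div_le_div_iff₀ (by positivity) hR0]
    have : B * R + 1 ≤ (B + 1) * R := by nlinarith
    nlinarith
  have h2 : 128 * (B + 1) / R ≤ v / 4 := by
    rw [div_le_iff₀ hR0]
    have h3 : 512 * (B + 1) ≤ R * v := by rwa [div_le_iff₀ hvar] at hRv
    nlinarith
  have h4 := hvarle R hR0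
  linarith

end General

/-! ## §2 Docked: the lattice partition function of a fluctuating action has Fisher zeros -/

section ActionZ

variable {d L n : ℕ} [NeZero L] {S : AmbConfig d L n → ℝ}

/-- **Fluctuating actions have Fisher zeros.** For a smooth action `S` on the ambient link space
whose restriction to `SU(n)^E` has positive variance under `D[U]`, the complexified partition
function `Z(s) = ∫ D[U] e^{-sS}` vanishes somewhere: the hypothesis `Z(s₀) = 0` of THEOREM F′/F″/S
is inhabited. [ours] -/
theorem exists_actionZ_eq_zero_of_variance_pos (hS : ContDiff ℝ ∞ S)
    (hvar : 0 < variance (fun U => S (coeConfig U))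
      (trivialMeasure (Matrix.specialUnitaryGroup (Fin n) ℂ) d L)) :
    ∃ s₀ : ℂ, complexMGF (fun U => -S (coeConfig U))
      (trivialMeasure (Matrix.specialUnitaryGroup (Fin n) ℂ) d L) s₀ = 0 := by
  obtain ⟨b, hb⟩ := exists_abs_le_of_contDiff hS
  have hm : AEMeasurable (fun U => -S (coeConfig U))
      (trivialMeasure (Matrix.specialUnitaryGroup (Fin n) ℂ) d L) :=
    (integrable_trivialMeasure_of_continuous (continuous_comp_coeConfig hS).neg).aemeasurable
  refine exists_zero_complexMGF_of_variance_pos (b := b) hm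
    (ae_of_all _ fun U => by simpa using hb U) ?_
  rw [variance_fun_neg]
  exact hvar

/-- The Fisher zero set `F_Z` of a fluctuating action is non-empty. [ours] -/
theorem actionZ_zeroSet_nonempty (hS : ContDiff ℝ ∞ S)
    (hvar : 0 < variance (fun U => S (coeConfig U))
      (trivialMeasure (Matrix.specialUnitaryGroup (Fin n) ℂ) d L)) :
    {s : ℂ | complexMGF (fun U => -S (coeConfig U))
      (trivialMeasure (Matrix.specialUnitaryGroup (Fin n) ℂ) d L) s = 0}.Nonempty :=
  exists_actionZ_eq_zero_of_variance_pos hS hvar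

/-- **Every real coupling is at positive, finite quasihyperbolic "height": `0 < dist(x, F_Z)`** for a
fluctuating action (the zero set is closed, non-empty and off the real axis), so the greedy
staircase of THEOREM S♯ strictly advances at every stage. [ours] -/
theorem infDist_actionZ_zeroSet_pos (hS : ContDiff ℝ ∞ S)
    (hvar : 0 < variance (fun U => S (coeConfig U))
      (trivialMeasure (Matrix.specialUnitaryGroup (Fin n) ℂ) d L)) (x : ℝ) :
    0 < infDist (x : ℂ) {s : ℂ | complexMGF (fun U => -S (coeConfig U))
      (trivialMeasure (Matrix.specialUnitaryGroup (Fin n) ℂ) d L) s = 0} := by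
  have hclosed : IsClosed {s : ℂ | complexMGF (fun U => -S (coeConfig U))
      (trivialMeasure (Matrix.specialUnitaryGroup (Fin n) ℂ) d L) s = 0} :=
    isClosed_eq (differentiable_actionZ hS).continuous continuous_const
  refine (hclosed.notMem_iff_infDist_pos (actionZ_zeroSet_nonempty hS hvar)).mp ?_
  intro hx
  have hpos : 0 < mgf (fun U => -S (coeConfig U))
      (trivialMeasure (Matrix.specialUnitaryGroup (Fin n) ℂ) d L) x :=
    mgf_pos (integrable_trivialMeasure_of_continuous (Real.continuous_exp.comp
      (continuous_const.mul (continuous_comp_coeConfig hS).neg)))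
  have h0 : ((mgf (fun U => -S (coeConfig U))
      (trivialMeasure (Matrix.specialUnitaryGroup (Fin n) ℂ) d L) x : ℝ) : ℂ) = 0 := by
    rw [← complexMGF_ofReal]; exact hx
  exact hpos.ne' (by exact_mod_cast h0)

end ActionZ

end Summit.Ventures.LatticeQCDFlow.TrivializingMaps
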